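import Summits.MatrixMultiplication.MatrixMultiplication.Theorems.SoloBlindConeLift

/-!
# Conjecture E follows from a hypergraph Kraft inequality (all ranks)

Sub-programme (K₃), H-good half (Conjecture E: `soloBlindMass h S σ ≤ 1/2` for `h` zero-sum free on `S` in a
group of exponent `3` and `σ` H-good, `∑_T h ≠ σ + σ` for all `T ⊆ S`).

THE ATOM HYPERGRAPH.  Let `F` be the set of all representations of `σ` (`soloBlindSeqRepAll`).  For `x ∈ S` the
ATOM of `x` is `J_x = {T ∈ F : x ∈ T}`; the atom hypergraph has vertex set `F` and edge set `P = {J_x : x ∈ S}`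
(`soloBlindAtomHg`).  Zero-sum freeness and H-goodness of `σ` make it ADMISSIBLE (`soloBlindHgAdmissible`,
`soloBlind_atomHg_admissible`): distinct vertices are separated by an edge; every `c : F → 𝔽₃` with `∑ c = 1`
has `∑_{T ∈ J} c T = 1` on some edge `J`; and every `c` with `∑ c = 0` takes the value `1` on some edge iff it
takes the value `2` on some edge.  [Double counting (`soloBlind_atom_double_count`):
`∑_{x ∈ S} c(J_x) • h x = (∑_T c T) • σ`, so `U = {x : c(J_x) = 1}`, `V = {x : c(J_x) = 2}` satisfy
`∑_U h + 2 ∑_V h = (∑ c) • σ` (`soloBlind_atom_identity`); `U = ∅` with `∑ c = 1` gives `∑_V h = σ + σ`, and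
with `∑ c = 0` exactly one of `U, V` empty gives a zero sum.]  The degree of the vertex `T` is at most `|T|`, so
`soloBlindMass h S σ ≤` the Kraft sum `∑_{T ∈ F} 2^{-deg T}` of the atom hypergraph (`soloBlind_mass_le_hgKraft`).

THE HYPERGRAPH KRAFT CONJECTURE (`soloBlindHgKraftConj W`): every admissible hypergraph whose edges lie inside its
finite vertex set `F ⊆ W` has `∑_{v ∈ F} 2^{-deg v} ≤ 1/2`.  MAIN THEOREMS: `soloBlind_conjE_of_hgKraft` — the
conjecture for `W = Finset ι` implies Conjecture E for every `h : ι → G`; `soloBlind_kraft_of_hgKraft` — hence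
the full Kraft inequality `soloBlindMass ≤ 1` (through the cone, `soloBlind_kraft_of_conjE`).  Outside the kernel
the conjecture has been verified for `|F| ≤ 5` by complete enumeration; it is in fact equivalent to Conjecture E
(an admissible hypergraph is realised by a zero-sum-free sequence), which is not formalised here.
-/

namespace Summit.MatrixMultiplication.MatrixMultiplication.Theorems

open Finset

universe u v

section Hypergraph

variable {W : Type*}

/-- The value `∑_{v ∈ J} c v` of a functional `c : W → 𝔽₃` on an edge `J`. -/
def soloBlindHgVal (c : W → ZMod 3) (J : Finset W) : ZMod 3 :=
  ∑ v ∈ J, c v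

/-- The degree of the vertex `v` in the hypergraph `P`: the number of edges containing `v`. -/
def soloBlindHgDeg [DecidableEq W] (P : Finset (Finset W)) (v : W) : ℕ :=
  (P.filter (fun J => v ∈ J)).card

/-- The Kraft sum `∑_{v ∈ F} 2^{-deg v}` of a hypergraph `P` on the vertex set `F`. -/
def soloBlindHgKraft [DecidableEq W] (F : Finset W) (P : Finset (Finset W)) : ℚ :=
  ∑ v ∈ F, (1 / 2 : ℚ) ^ soloBlindHgDeg P v

/-- ADMISSIBLE hypergraph on the vertex set `F`: edges separate vertices; every `𝔽₃`-functional with total `1`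
takes the value `1` on some edge; every functional with total `0` takes the value `1` on some edge iff it takes
the value `2` on some edge. -/
def soloBlindHgAdmissible (F : Finset W) (P : Finset (Finset W)) : Prop :=
  (∀ u ∈ F, ∀ w ∈ F, u ≠ w → ∃ J ∈ P, ¬ (u ∈ J ↔ w ∈ J)) ∧
  (∀ c : W → ZMod 3, ∑ v ∈ F, c v = 1 → ∃ J ∈ P, soloBlindHgVal c J = 1) ∧
  (∀ c : W → ZMod 3, ∑ v ∈ F, c v = 0 →
    ((∃ J ∈ P, soloBlindHgVal c J = 1) ↔ (∃ J ∈ P, soloBlindHgVal c J = 2)))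

/-- THE HYPERGRAPH KRAFT CONJECTURE over the vertex type `W`: every admissible hypergraph whose edges lie inside
its finite vertex set `F` has Kraft sum at most `1/2`. -/
def soloBlindHgKraftConj (W : Type*) [DecidableEq W] : Prop :=
  ∀ (F : Finset W) (P : Finset (Finset W)), (∀ J ∈ P, J ⊆ F) →
    soloBlindHgAdmissible F P → soloBlindHgKraft F P ≤ 1 / 2

end Hypergraph

variable {ι : Type v} [DecidableEq ι]
variable {G : Type u} [AddCommGroup G] [DecidableEq G]

omit [DecidableEq G] in
/-- In a group of exponent `3`, `n • g` only depends on `n mod 3`. -/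
theorem soloBlind_nsmul_mod_three (three : ∀ g : G, g + g + g = 0) (n : ℕ) (g : G) :
    n • g = (n % 3) • g := by
  have h3 : (3 : ℕ) • g = 0 := by
    rw [show (3 : ℕ) = 2 + 1 from rfl, add_nsmul, two_nsmul, one_nsmul]; exact three g
  conv_lhs => rw [← Nat.mod_add_div n 3]
  rw [add_nsmul, mul_nsmul, h3, nsmul_zero, add_zero]

/-- The value of a sum in `ZMod 3` is the sum of the values modulo `3`. -/
theorem soloBlind_val_sum_mod_three {α : Type*} (s : Finset α) (c : α → ZMod 3) :
    (∑ a ∈ s, c a).val = (∑ a ∈ s, (c a).val) % 3 := by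
  have hc : (((∑ a ∈ s, (c a).val : ℕ)) : ZMod 3) = ∑ a ∈ s, c a := by
    rw [Nat.cast_sum]; exact Finset.sum_congr rfl (fun a _ => ZMod.natCast_zmod_val (c a))
  rw [← hc, ZMod.val_natCast]

/-- The atom of `x`: the representations of `σ` containing `x`. -/
def soloBlindAtom (h : ι → G) (S : Finset ι) (σ : G) (x : ι) : Finset (Finset ι) :=
  (soloBlindSeqRepAll h S σ).filter (fun T => x ∈ T)

/-- The atom hypergraph of the target `σ`: vertex set = all representations, edges = the atoms `J_x`, `x ∈ S`. -/
def soloBlindAtomHg (h : ι → G) (S : Finset ι) (σ : G) : Finset (Finset (Finset ι)) :=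
  S.image (soloBlindAtom h S σ)

/-- Membership in an atom. -/
theorem soloBlind_mem_atom {h : ι → G} {S : Finset ι} {σ : G} {x : ι} {T : Finset ι} :
    T ∈ soloBlindAtom h S σ x ↔ T ∈ soloBlindSeqRepAll h S σ ∧ x ∈ T := by
  simp [soloBlindAtom]

/-- DOUBLE COUNTING: `∑_{x ∈ S} (∑_{T ∈ J_x} (c T).val) • h x = (∑_{T ∈ F} (c T).val) • σ`. -/
theorem soloBlind_atom_double_count (h : ι → G) (S : Finset ι) (σ : G) (c : Finset ι → ZMod 3) :
    ∑ x ∈ S, (∑ T ∈ soloBlindAtom h S σ x, (c T).val) • h x =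
      (∑ T ∈ soloBlindSeqRepAll h S σ, (c T).val) • σ := by
  calc ∑ x ∈ S, (∑ T ∈ soloBlindAtom h S σ x, (c T).val) • h x
      = ∑ x ∈ S, ∑ T ∈ soloBlindSeqRepAll h S σ, (if x ∈ T then (c T).val • h x else 0) := by
        refine Finset.sum_congr rfl (fun x _ => ?_)
        rw [Finset.sum_smul, soloBlindAtom, Finset.sum_filter]
    _ = ∑ T ∈ soloBlindSeqRepAll h S σ, ∑ x ∈ S, (if x ∈ T then (c T).val • h x else 0) :=
        Finset.sum_comm
    _ = ∑ T ∈ soloBlindSeqRepAll h S σ, (c T).val • σ := by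
        refine Finset.sum_congr rfl (fun T hT => ?_)
        obtain ⟨hTS, hsum⟩ := soloBlind_mem_seqRepAll.mp hT
        rw [← Finset.sum_filter, Finset.filter_mem_eq_inter, Finset.inter_eq_right.mpr hTS,
          ← Finset.smul_sum, hsum]
    _ = (∑ T ∈ soloBlindSeqRepAll h S σ, (c T).val) • σ := Finset.sum_smul.symm

/-- THE RESIDUE IDENTITY: with `r x = (∑_{T ∈ J_x} (c T).val) mod 3`, `U = {r = 1}`, `V = {r = 2}`:
`∑_U h + (∑_V h + ∑_V h) = ((∑_T (c T).val) mod 3) • σ`. -/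
theorem soloBlind_atom_identity (three : ∀ g : G, g + g + g = 0) (h : ι → G) (S : Finset ι) (σ : G)
    (c : Finset ι → ZMod 3) :
    ∑ x ∈ S.filter (fun x => (∑ T ∈ soloBlindAtom h S σ x, (c T).val) % 3 = 1), h x +
      (∑ x ∈ S.filter (fun x => (∑ T ∈ soloBlindAtom h S σ x, (c T).val) % 3 = 2), h x +
        ∑ x ∈ S.filter (fun x => (∑ T ∈ soloBlindAtom h S σ x, (c T).val) % 3 = 2), h x) =
      ((∑ T ∈ soloBlindSeqRepAll h S σ, (c T).val) % 3) • σ := by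
  rw [← soloBlind_nsmul_mod_three three, ← soloBlind_atom_double_count h S σ c, ← Finset.sum_add_distrib,
    Finset.sum_filter, Finset.sum_filter, ← Finset.sum_add_distrib]
  refine Finset.sum_congr rfl (fun x _ => ?_)
  rw [soloBlind_nsmul_mod_three three (∑ T ∈ soloBlindAtom h S σ x, (c T).val)]
  have hlt : (∑ T ∈ soloBlindAtom h S σ x, (c T).val) % 3 < 3 := Nat.mod_lt _ (by norm_num)
  generalize (∑ T ∈ soloBlindAtom h S σ x, (c T).val) % 3 = r at hlt ⊢
  interval_cases r <;> simp [two_nsmul]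

/-- The value of `c` on the atom `J_x` is `1` iff the residue `r x` is `1`, and `2` iff it is `2`. -/
theorem soloBlind_atom_val_eq {h : ι → G} {S : Finset ι} {σ : G} (c : Finset ι → ZMod 3) (x : ι) (k : ℕ)
    (hk : k < 3) :
    soloBlindHgVal c (soloBlindAtom h S σ x) = (k : ZMod 3) ↔
      (∑ T ∈ soloBlindAtom h S σ x, (c T).val) % 3 = k := by
  have hv := soloBlind_val_sum_mod_three (soloBlindAtom h S σ x) c
  unfold soloBlindHgVal
  constructor
  · intro h1
    rw [← hv, h1, ZMod.val_natCast, Nat.mod_eq_of_lt hk]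
  · intro h1
    rw [← hv] at h1
    rw [← h1, ZMod.natCast_zmod_val]

/-- THE ATOM HYPERGRAPH IS ADMISSIBLE (zero-sum free + H-good). -/
theorem soloBlind_atomHg_admissible (three : ∀ g : G, g + g + g = 0) {h : ι → G} {S : Finset ι} {σ : G}
    (zsf : ∀ T ⊆ S, T.Nonempty → ∑ i ∈ T, h i ≠ 0) (hgood : ∀ T ⊆ S, ∑ i ∈ T, h i ≠ σ + σ) :
    soloBlindHgAdmissible (soloBlindSeqRepAll h S σ) (soloBlindAtomHg h S σ) := by
  refine ⟨?_, ?_, ?_⟩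
  · -- separation
    intro u hu w hw huw
    have hx : ∃ x, ¬ (x ∈ u ↔ x ∈ w) := by
      by_contra hcon
      push Not at hcon
      exact huw (Finset.ext hcon)
    obtain ⟨x, hx⟩ := hx
    have hxS : x ∈ S := by
      by_cases hxu : x ∈ u
      · exact (soloBlind_mem_seqRepAll.mp hu).1 hxu
      · have hxw : x ∈ w := by tauto
        exact (soloBlind_mem_seqRepAll.mp hw).1 hxw
    refine ⟨soloBlindAtom h S σ x, Finset.mem_image.mpr ⟨x, hxS, rfl⟩, ?_⟩
    simpa [soloBlind_mem_atom, hu, hw] using hx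
  · -- functionals of total 1
    intro c hc1
    by_contra hnone
    push Not at hnone
    set U := S.filter (fun x => (∑ T ∈ soloBlindAtom h S σ x, (c T).val) % 3 = 1) with hU
    set V := S.filter (fun x => (∑ T ∈ soloBlindAtom h S σ x, (c T).val) % 3 = 2) with hV
    have hid := soloBlind_atom_identity three h S σ c
    have hm : (∑ T ∈ soloBlindSeqRepAll h S σ, (c T).val) % 3 = 1 := by
      rw [← soloBlind_val_sum_mod_three, hc1]; rfl
    have hUe : U = ∅ := by
      rw [Finset.eq_empty_iff_forall_notMem]
      intro x hx
      obtain ⟨hxS, hx1⟩ := Finset.mem_filter.mp hx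
      exact hnone _ (Finset.mem_image.mpr ⟨x, hxS, rfl⟩)
        ((soloBlind_atom_val_eq c x 1 (by norm_num)).mpr (by simpa using hx1))
    rw [← hU, ← hV, hm, hUe, Finset.sum_empty, zero_add, one_nsmul] at hid
    have hVS : V ⊆ S := Finset.filter_subset _ _
    apply hgood V hVS
    calc ∑ i ∈ V, h i = ∑ i ∈ V, h i + (∑ i ∈ V, h i + ∑ i ∈ V, h i + ∑ i ∈ V, h i) := by
          rw [three, add_zero]
      _ = (∑ i ∈ V, h i + ∑ i ∈ V, h i) + (∑ i ∈ V, h i + ∑ i ∈ V, h i) := by abel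
      _ = σ + σ := by rw [hid]
  · -- functionals of total 0
    intro c hc0
    set U := S.filter (fun x => (∑ T ∈ soloBlindAtom h S σ x, (c T).val) % 3 = 1) with hU
    set V := S.filter (fun x => (∑ T ∈ soloBlindAtom h S σ x, (c T).val) % 3 = 2) with hV
    have hid := soloBlind_atom_identity three h S σ c
    have hm : (∑ T ∈ soloBlindSeqRepAll h S σ, (c T).val) % 3 = 0 := by
      rw [← soloBlind_val_sum_mod_three, hc0]; rfl
    rw [← hU, ← hV, hm, zero_nsmul] at hid
    have hUS : U ⊆ S := Finset.filter_subset _ _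
    have hVS : V ⊆ S := Finset.filter_subset _ _
    -- an edge with value `k` is an atom `J_x` with `x` of residue `k`
    have mem_of_val : ∀ k : ℕ, k < 3 → (∃ J ∈ soloBlindAtomHg h S σ, soloBlindHgVal c J = (k : ZMod 3)) →
        ∃ x ∈ S, (∑ T ∈ soloBlindAtom h S σ x, (c T).val) % 3 = k := by
      intro k hk ⟨J, hJ, hJk⟩
      obtain ⟨x, hxS, rfl⟩ := Finset.mem_image.mp hJ
      exact ⟨x, hxS, (soloBlind_atom_val_eq c x k hk).mp hJk⟩
    have val_of_mem : ∀ k : ℕ, k < 3 → (∃ x ∈ S, (∑ T ∈ soloBlindAtom h S σ x, (c T).val) % 3 = k) →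
        ∃ J ∈ soloBlindAtomHg h S σ, soloBlindHgVal c J = (k : ZMod 3) := by
      intro k hk ⟨x, hxS, hxk⟩
      exact ⟨soloBlindAtom h S σ x, Finset.mem_image.mpr ⟨x, hxS, rfl⟩,
        (soloBlind_atom_val_eq c x k hk).mpr hxk⟩
    constructor
    · intro h1
      by_contra h2
      have hVe : V = ∅ := by
        rw [Finset.eq_empty_iff_forall_notMem]
        intro x hx
        obtain ⟨hxS, hx2⟩ := Finset.mem_filter.mp hx
        exact h2 (by simpa using val_of_mem 2 (by norm_num) ⟨x, hxS, hx2⟩)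
      rw [hVe, Finset.sum_empty, add_zero, add_zero] at hid
      obtain ⟨x, hxS, hx1⟩ := mem_of_val 1 (by norm_num) (by simpa using h1)
      have hUne : U.Nonempty := ⟨x, Finset.mem_filter.mpr ⟨hxS, hx1⟩⟩
      exact zsf U hUS hUne hid
    · intro h2
      by_contra h1
      have hUe : U = ∅ := by
        rw [Finset.eq_empty_iff_forall_notMem]
        intro x hx
        obtain ⟨hxS, hx1⟩ := Finset.mem_filter.mp hx
        exact h1 (by simpa using val_of_mem 1 (by norm_num) ⟨x, hxS, hx1⟩)
      rw [hUe, Finset.sum_empty, zero_add] at hid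
      obtain ⟨x, hxS, hx2⟩ := mem_of_val 2 (by norm_num) (by simpa using h2)
      have hVne : V.Nonempty := ⟨x, Finset.mem_filter.mpr ⟨hxS, hx2⟩⟩
      apply zsf V hVS hVne
      have h3 := three (∑ i ∈ V, h i)
      rwa [hid, zero_add] at h3

/-- The degree of a representation `T` in the atom hypergraph is at most `|T|`. -/
theorem soloBlind_atomHg_deg_le {h : ι → G} {S : Finset ι} {σ : G} {T : Finset ι}
    (hT : T ∈ soloBlindSeqRepAll h S σ) : soloBlindHgDeg (soloBlindAtomHg h S σ) T ≤ T.card := by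
  have _ := hT
  unfold soloBlindHgDeg
  calc ((soloBlindAtomHg h S σ).filter (fun J => T ∈ J)).card
      ≤ ((S.filter (fun x => x ∈ T)).image (soloBlindAtom h S σ)).card := by
        apply Finset.card_le_card
        intro J hJ
        obtain ⟨hJP, hTJ⟩ := Finset.mem_filter.mp hJ
        obtain ⟨x, hxS, rfl⟩ := Finset.mem_image.mp hJP
        exact Finset.mem_image.mpr ⟨x, Finset.mem_filter.mpr ⟨hxS, (soloBlind_mem_atom.mp hTJ).2⟩, rfl⟩
    _ ≤ (S.filter (fun x => x ∈ T)).card := Finset.card_image_le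
    _ ≤ T.card := Finset.card_le_card (fun x hx => (Finset.mem_filter.mp hx).2)

/-- The Kraft mass is at most the Kraft sum of the atom hypergraph. -/
theorem soloBlind_mass_le_hgKraft (h : ι → G) (S : Finset ι) (σ : G) :
    soloBlindMass h S σ ≤ soloBlindHgKraft (soloBlindSeqRepAll h S σ) (soloBlindAtomHg h S σ) := by
  unfold soloBlindMass soloBlindHgKraft
  exact Finset.sum_le_sum (fun T hT =>
    pow_le_pow_of_le_one (by norm_num) (by norm_num) (soloBlind_atomHg_deg_le hT))

/-- The edges of the atom hypergraph lie inside its vertex set. -/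
theorem soloBlind_atomHg_edge_subset (h : ι → G) (S : Finset ι) (σ : G) :
    ∀ J ∈ soloBlindAtomHg h S σ, J ⊆ soloBlindSeqRepAll h S σ := by
  intro J hJ
  obtain ⟨x, _, rfl⟩ := Finset.mem_image.mp hJ
  exact Finset.filter_subset _ _

/-- MAIN THEOREM: the hypergraph Kraft conjecture (over the vertex type `Finset ι`) implies CONJECTURE E for
every `h : ι → G`, `G` of exponent `3`, `S` zero-sum free, `σ` H-good — in every rank. -/
theorem soloBlind_conjE_of_hgKraft (hC : soloBlindHgKraftConj (Finset ι)) (three : ∀ g : G, g + g + g = 0)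
    (h : ι → G) (S : Finset ι) (σ : G) (zsf : ∀ T ⊆ S, T.Nonempty → ∑ i ∈ T, h i ≠ 0)
    (hgood : ∀ T ⊆ S, ∑ i ∈ T, h i ≠ σ + σ) : soloBlindMass h S σ ≤ 1 / 2 :=
  (soloBlind_mass_le_hgKraft h S σ).trans
    (hC _ _ (soloBlind_atomHg_edge_subset h S σ) (soloBlind_atomHg_admissible three zsf hgood))

omit [DecidableEq ι] in
/-- COROLLARY: the hypergraph Kraft conjecture (over all vertex types `Finset κ`) implies the full Kraft inequality
(K₃) `soloBlindMass h S σ ≤ 1` for zero-sum-free `S` and every target, via the cone reduction. -/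
theorem soloBlind_kraft_of_hgKraft (hC : ∀ {κ : Type v} [DecidableEq κ], soloBlindHgKraftConj (Finset κ))
    (three : ∀ g : G, g + g + g = 0) (h : ι → G) (S : Finset ι)
    (zsf : ∀ T ⊆ S, T.Nonempty → ∑ i ∈ T, h i ≠ 0) (σ : G) : soloBlindMass h S σ ≤ 1 :=
  soloBlind_kraft_of_conjE
    (fun three' h' S' τ' zsf' hgood' => by
      classical
      exact soloBlind_conjE_of_hgKraft hC three' h' S' τ' zsf' hgood')
    three h S zsf σ

end Summit.MatrixMultiplication.MatrixMultiplication.Theorems
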